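import Mathlib
import Literature.Probability.Distributions.WeakConvergenceCoupling
import Literature.Probability.Distributions.FiniteRangeCouplingLift
import Literature.Probability.RandomPlanarGeometry.SLEDrivingCoupling
import HarnessLib

/-!
# Soft machine, brick 1: sequential Prokhorov extraction on a σ-compact support, presented on `[0, 1]`

Crux `Summit.CriticalPhenomena.CardyFormulaZ2.Theses.CardyMagicRigidity.NestingRigidity`
(stmt-CriticalPhenomena-4835), line `positive-cone-weight-doubling`, registered stub `stub_tamePrecompactness :
TamePrecompact zEns ∧ TamePrecompact tEns` — the SOFT MACHINE "tight windowed loop-collection laws in the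
Aizenman–Burchard space ⇒ a SEQUENTIAL `d_CN`-subsequential limit presented on `([0,1], Leb)`".

This file is the purely measure-theoretic first brick.  Mathlib's Prokhorov theorem
(`isCompact_setOf_probabilityMeasure_mass_eq_compl_isCompact_le`) gives COMPACTNESS of a tight set of laws on any
Hausdorff Borel space, but the space of laws on the (non-separable) Aizenman–Burchard space of loop collections is
not known to be sequential, so a SEQUENCE of tight laws does not obviously have a convergent SUBSEQUENCE.  We prove
that it does, for laws on an extended metric space `S` giving uniformly small mass to the complements of an
increasing sequence of compact sets `K n` (`SoftMachine.exists_subseq_tendsto_of_mass_le`, registered anchor):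
all the laws live on the closure `Σ̄` of `⋃ K n`, a SEPARABLE closed subspace, on which the topology of weak
convergence is (pseudo-)metrisable (Lévy–Prokhorov, Mathlib), so Prokhorov's compact set of laws is sequentially
compact there; the subsequential limit is pushed back to `S`.  If moreover `S` is complete, `Σ̄` is Polish, so the
limit law is the image of Lebesgue measure on `[0, 1]` under a Borel map with values in `Σ̄`
(`MeasureTheory.Measure.exists_measurable_map_eq`), and weak convergence to a tight limit yields couplings with
small exceptional `edist`-events (`Literature.Probability.Distributions.exists_coupling_of_tendsto_of_le_compact`)
— `SoftMachine.exists_subseq_presentation`.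
-/

noncomputable section

open MeasureTheory Set Filter Metric TopologicalSpace Function
open scoped Topology ENNReal NNReal unitInterval

namespace Summit.CriticalPhenomena.CardyFormulaZ2.Cruxes.NestingRigidity.PositiveConeWeightDoubling

namespace SoftMachine

variable {S : Type*} [EMetricSpace S] [MeasurableSpace S] [BorelSpace S]

omit [MeasurableSpace S] [BorelSpace S] in
/-- The closure of a countable union of compact sets of an extended metric space is a separable set. -/
theorem isSeparable_closure_iUnion {K : ℕ → Set S} (hK : ∀ n, IsCompact (K n)) :
    IsSeparable (closure (⋃ n, K n)) :=
  (isSeparable_iUnion.2 fun n ↦ (hK n).isSeparable).closure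

omit [BorelSpace S] in
/-- A probability measure giving mass `≤ u n` to `(K n)ᶜ` for a sequence `u` with arbitrarily small values is
carried by `closure (⋃ K n)`. -/
theorem measure_compl_closure_iUnion_eq_zero (μ : Measure S) {u : ℕ → ℝ≥0} (hu : Tendsto u atTop (𝓝 0))
    {K : ℕ → Set S} (hmass : ∀ n, μ (K n)ᶜ ≤ u n) : μ (closure (⋃ n, K n))ᶜ = 0 := by
  refine le_antisymm (ENNReal.le_of_forall_pos_le_add fun ε hε _ ↦ ?_) bot_le
  rw [zero_add]
  obtain ⟨n, hn⟩ := (hu.eventually (gt_mem_nhds (show (0 : ℝ≥0) < ε from hε))).exists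
  calc μ (closure (⋃ n, K n))ᶜ ≤ μ (K n)ᶜ :=
        measure_mono (compl_subset_compl.2 ((subset_iUnion K n).trans subset_closure))
    _ ≤ u n := hmass n
    _ ≤ ε := by exact_mod_cast hn.le

/-- **Sequential Prokhorov extraction** (registered anchor).  Let `μ k`, `k ∈ ℕ`, be Borel probability measures on
an extended metric space `S`, and `K n` an increasing sequence of compact sets with `μ k (K n)ᶜ ≤ u n` for all
`k, n`, where `u n → 0`.  Then some subsequence `μ (φ k)` converges weakly to a probability measure `ν` with the
same mass bounds `ν (K n)ᶜ ≤ u n`.  (All laws live on the separable closed subspace `closure (⋃ K n)`, where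
Prokhorov's compact set `{ν | ∀ n, ν (K n)ᶜ ≤ u n}` is metrisable, hence sequentially compact.) -/
theorem exists_subseq_tendsto_of_mass_le (μ : ℕ → ProbabilityMeasure S) {u : ℕ → ℝ≥0}
    (hu : Tendsto u atTop (𝓝 0)) {K : ℕ → Set S} (hK : ∀ n, IsCompact (K n)) (hmono : Monotone K)
    (hmass : ∀ k n, (μ k : Measure S) (K n)ᶜ ≤ u n) :
    ∃ φ : ℕ → ℕ, StrictMono φ ∧ ∃ ν : ProbabilityMeasure S, (∀ n, (ν : Measure S) (K n)ᶜ ≤ u n) ∧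
      (ν : Measure S) (closure (⋃ n, K n))ᶜ = 0 ∧ Tendsto (μ ∘ φ) atTop (𝓝 ν) := by
  classical
  set C : Set S := closure (⋃ n, K n) with hC
  have hCc : IsClosed C := isClosed_closure
  have hCm : MeasurableSet C := hCc.measurableSet
  have hemb : MeasurableEmbedding (Subtype.val : C → S) := MeasurableEmbedding.subtype_coe hCm
  haveI : SeparableSpace C := (isSeparable_closure_iUnion hK).separableSpace
  -- the laws restricted to the separable closed subspace `C`
  have hμC : ∀ k, (μ k : Measure S) Cᶜ = 0 := fun k ↦
    measure_compl_closure_iUnion_eq_zero _ hu (hmass k)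
  have hprob : ∀ k, IsProbabilityMeasure ((μ k : Measure S).comap (Subtype.val : C → S)) := by
    intro k
    refine ⟨?_⟩
    rw [hemb.comap_apply, image_univ, Subtype.range_coe]
    exact (prob_compl_eq_zero_iff hCm).1 (hμC k)
  set μ' : ℕ → ProbabilityMeasure C := fun k ↦ ⟨(μ k : Measure S).comap Subtype.val, hprob k⟩ with hμ'
  set K' : ℕ → Set C := fun n ↦ Subtype.val ⁻¹' K n with hK'
  have hK'c : ∀ n, IsCompact (K' n) := fun n ↦
    hCc.isClosedEmbedding_subtypeVal.isCompact_preimage (hK n)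
  have hK'mono : Monotone K' := fun m n hmn ↦ preimage_mono (hmono hmn)
  have hmass' : ∀ k n, (μ' k : Measure C) (K' n)ᶜ ≤ u n := by
    intro k n
    change ((μ k : Measure S).comap Subtype.val) (Subtype.val ⁻¹' K n)ᶜ ≤ u n
    rw [hemb.comap_apply]
    refine le_trans (measure_mono ?_) (hmass k n)
    rintro _ ⟨x, hx, rfl⟩
    exact hx
  -- Prokhorov's compact set of laws on `C`, sequentially compact by metrisability
  set M : Set (ProbabilityMeasure C) := {ν | ∀ n, ν (K' n)ᶜ ≤ u n} with hM
  have hMc : IsCompact M :=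
    isCompact_setOf_probabilityMeasure_mass_eq_compl_isCompact_le hu hK'c (Or.inr hK'mono)
  have hμ'M : ∀ k, μ' k ∈ M := by
    intro k n
    have h := hmass' k n
    rw [← ENNReal.coe_le_coe, ProbabilityMeasure.ennreal_coeFn_eq_coeFn_toMeasure]
    exact h
  obtain ⟨ν', hν'M, φ, hφ, hlim⟩ := hMc.isSeqCompact hμ'M
  -- push the limit back to `S`
  have hval : Continuous (Subtype.val : C → S) := continuous_subtype_val
  refine ⟨φ, hφ, ν'.map hval.measurable.aemeasurable, ?_, ?_, ?_⟩
  · intro n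
    rw [ProbabilityMeasure.toMeasure_map, Measure.map_apply hval.measurable (hK n).isClosed.measurableSet.compl,
      preimage_compl]
    have h := hν'M n
    rw [← ENNReal.coe_le_coe, ProbabilityMeasure.ennreal_coeFn_eq_coeFn_toMeasure] at h
    exact h
  · rw [ProbabilityMeasure.toMeasure_map, Measure.map_apply hval.measurable hCm.compl]
    convert measure_empty (μ := (ν' : Measure C))
    ext x
    simp
  · have h := ProbabilityMeasure.tendsto_map_of_tendsto_of_continuous _ _ hlim hval
    refine (tendsto_congr fun k ↦ ?_).1 h
    -- `(μ (φ k)).comap val` pushed forward along `val` is `μ (φ k)`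
    apply ProbabilityMeasure.toMeasure_injective
    rw [ProbabilityMeasure.toMeasure_map]
    change ((μ (φ k) : Measure S).comap Subtype.val).map Subtype.val = (μ (φ k) : Measure S)
    rw [hemb.map_comap, Subtype.range_coe]
    exact Measure.restrict_eq_self_of_ae_mem (by rw [ae_iff]; exact hμC (φ k))

/-- **Sequential subsequential limit, presented on `[0, 1]`, with couplings.**  In the situation of
`exists_subseq_tendsto_of_mass_le` on a COMPLETE extended metric space: along some subsequence `φ` the laws
`μ (φ k)` converge weakly to a probability measure `ν` with the same mass bounds; `ν` is the image of Lebesgue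
measure on `[0, 1]` under a Borel map `f` with values in the Polish subspace `closure (⋃ K n)`
(`MeasureTheory.Measure.exists_measurable_map_eq`); and for every `η > 0`, eventually in `k` there is a coupling
of `μ (φ k)` and `ν` under which the two coordinates are at `edist ≥ η` with probability `≤ 3η`
(`Literature.Probability.Distributions.exists_coupling_of_tendsto_of_le_compact`). -/
theorem exists_subseq_presentation [CompleteSpace S] (μ : ℕ → ProbabilityMeasure S) {u : ℕ → ℝ≥0}
    (hu : Tendsto u atTop (𝓝 0)) {K : ℕ → Set S} (hK : ∀ n, IsCompact (K n)) (hmono : Monotone K)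
    (hmass : ∀ k n, (μ k : Measure S) (K n)ᶜ ≤ u n) :
    ∃ φ : ℕ → ℕ, StrictMono φ ∧ ∃ ν : ProbabilityMeasure S, (∀ n, (ν : Measure S) (K n)ᶜ ≤ u n) ∧
      Tendsto (μ ∘ φ) atTop (𝓝 ν) ∧
      (∃ f : unitInterval → S, Measurable f ∧ (∀ s, f s ∈ closure (⋃ n, K n)) ∧
        volume.map f = (ν : Measure S)) ∧
      ∀ η : ℝ, 0 < η → ∀ᶠ k in atTop, ∃ π : Measure (S × S), IsProbabilityMeasure π ∧
        π.map Prod.fst = (μ (φ k) : Measure S) ∧ π.map Prod.snd = (ν : Measure S) ∧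
        π {p | ENNReal.ofReal η ≤ edist p.1 p.2} ≤ 3 * ENNReal.ofReal η := by
  obtain ⟨φ, hφ, ν, hνmass, hνC, hlim⟩ := exists_subseq_tendsto_of_mass_le μ hu hK hmono hmass
  set C : Set S := closure (⋃ n, K n) with hC
  have hCc : IsClosed C := isClosed_closure
  have hCm : MeasurableSet C := hCc.measurableSet
  have hemb : MeasurableEmbedding (Subtype.val : C → S) := MeasurableEmbedding.subtype_coe hCm
  haveI : SeparableSpace C := (isSeparable_closure_iUnion hK).separableSpace
  haveI : CompleteSpace C := hCc.completeSpace_coe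
  haveI : SecondCountableTopology C := UniformSpace.secondCountable_of_separable C
  -- `C` carries `ν`, hence is nonempty
  have hCne : C.Nonempty := by
    by_contra h
    rw [not_nonempty_iff_eq_empty] at h
    have h1 : (ν : Measure S) univ = 0 := by rw [← compl_empty, ← h]; exact hνC
    exact one_ne_zero (measure_univ.symm.trans h1)
  haveI : Nonempty C := hCne.to_subtype
  haveI hprob : IsProbabilityMeasure ((ν : Measure S).comap (Subtype.val : C → S)) := by
    refine ⟨?_⟩
    rw [hemb.comap_apply, image_univ, Subtype.range_coe]
    exact (prob_compl_eq_zero_iff hCm).1 hνC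
  obtain ⟨f₀, hf₀, hmap⟩ := Measure.exists_measurable_map_eq ((ν : Measure S).comap (Subtype.val : C → S))
  refine ⟨φ, hφ, ν, hνmass, hlim, ⟨Subtype.val ∘ f₀, measurable_subtype_coe.comp hf₀, fun s ↦ (f₀ s).2, ?_⟩,
    fun η hη ↦ ?_⟩
  · rw [← Measure.map_map measurable_subtype_coe hf₀, hmap, hemb.map_comap, Subtype.range_coe]
    exact Measure.restrict_eq_self_of_ae_mem (by rw [ae_iff]; exact hνC)
  · -- a compact set carrying `ν` up to `η`
    have hη' : (0 : ℝ≥0∞) < ENNReal.ofReal η := ENNReal.ofReal_pos.2 hη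
    have hu' : Tendsto (fun n ↦ (u n : ℝ≥0∞)) atTop (𝓝 0) := by
      rw [← ENNReal.coe_zero]
      exact ENNReal.tendsto_coe.2 hu
    obtain ⟨n, hn⟩ := (hu'.eventually (gt_mem_nhds hη')).exists
    exact Literature.Probability.Distributions.exists_coupling_of_tendsto_of_le_compact hlim hη (hK n)
      ((hνmass n).trans hn.le)

omit [EMetricSpace S] [BorelSpace S] in
/-- **Realising a coupling of image laws on the base spaces `Ω × [0, 1]`.**  Let `Z : Ω → S` be measurable with
finitely many values on a standard Borel probability space `(Ω, P)`, let `f : [0,1] → S` present the law `ν`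
(`Leb ∘ f⁻¹ = ν`), and let `π` be a coupling of the law of `Z` and `ν`.  Then there is a coupling `R` of `P` and
Lebesgue measure under which the pair `(Z ω, f s)` gives every set at most its `π`-measure (lift along the
finitely-valued `Z`, `exists_coupling_lift_of_finite_range`, then transfer along `f`, `exists_coupling_map_snd_eq`;
outer measures only decrease under pull-back). -/
theorem exists_coupling_base [MeasurableSingletonClass S] {Ω : Type*} [MeasurableSpace Ω]
    [StandardBorelSpace Ω] [Nonempty Ω] (P : Measure Ω) [IsProbabilityMeasure P] {Z : Ω → S}
    (hZ : Measurable Z) (hfin : (Set.range Z).Finite) {ν : Measure S} {f : unitInterval → S}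
    (hf : Measurable f) (hfν : volume.map f = ν) {π : Measure (S × S)} [IsProbabilityMeasure π]
    (h1 : π.map Prod.fst = P.map Z) (h2 : π.map Prod.snd = ν) :
    ∃ R : Measure (Ω × unitInterval), R.map Prod.fst = P ∧ R.map Prod.snd = volume ∧
      ∀ E : Set (S × S), R {p | (Z p.1, f p.2) ∈ E} ≤ π E := by
  obtain ⟨T, hT, hT1, hT2, -, hTE⟩ :=
    Literature.Probability.Distributions.exists_coupling_lift_of_finite_range hZ hfin h1
  have hvol : (volume : Measure unitInterval).map f = T.map Prod.snd := by rw [hfν, hT2, h2]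
  obtain ⟨R, hR2, hR⟩ :=
    Literature.Probability.RandomPlanarGeometry.exists_coupling_map_snd_eq T volume hf hvol
  have hmeas : Measurable (Prod.map id f : Ω × unitInterval → Ω × S) := measurable_id.prodMap hf
  refine ⟨R, ?_, hR2, fun E ↦ ?_⟩
  · rw [← hT1, ← hR, Measure.map_map measurable_fst hmeas]
    rfl
  · calc R {p | (Z p.1, f p.2) ∈ E}
        = R (Prod.map id f ⁻¹' {q : Ω × S | (Z q.1, q.2) ∈ E}) := rfl
      _ ≤ R.map (Prod.map id f) {q : Ω × S | (Z q.1, q.2) ∈ E} := Measure.le_map_apply hmeas.aemeasurable _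
      _ = T {q : Ω × S | (Z q.1, q.2) ∈ E} := by rw [hR]
      _ ≤ π E := hTE E

end SoftMachine

/-- **Registered anchor** (`softMachine_seqLimit`): the soft machine's limit extraction in closed form — Borel
probability measures `μ k` on a complete extended metric space giving mass `≤ u n → 0` to the complements of an
increasing sequence of compact sets have a weakly convergent SUBSEQUENCE, whose limit obeys the same bounds, is
presented on `([0,1], Leb)` by a Borel map with values in `closure (⋃ K n)`, and is coupled to the `μ (φ k)` with
exceptional `edist`-events of probability `≤ 3η`, eventually, for every `η > 0`. -/
theorem softMachine_seqLimit : ∀ (S : Type) [EMetricSpace S] [CompleteSpace S] [MeasurableSpace S]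
    [BorelSpace S] (μ : ℕ → ProbabilityMeasure S) (u : ℕ → NNReal) (K : ℕ → Set S),
    Tendsto u atTop (𝓝 0) → (∀ n, IsCompact (K n)) → Monotone K →
    (∀ k n, (μ k : Measure S) (K n)ᶜ ≤ u n) →
    ∃ φ : ℕ → ℕ, StrictMono φ ∧ ∃ ν : ProbabilityMeasure S, (∀ n, (ν : Measure S) (K n)ᶜ ≤ u n) ∧
      Tendsto (μ ∘ φ) atTop (𝓝 ν) ∧
      (∃ f : unitInterval → S, Measurable f ∧ (∀ s, f s ∈ closure (⋃ n, K n)) ∧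
        volume.map f = (ν : Measure S)) ∧
      ∀ η : ℝ, 0 < η → ∀ᶠ k in atTop, ∃ π : Measure (S × S), IsProbabilityMeasure π ∧
        π.map Prod.fst = (μ (φ k) : Measure S) ∧ π.map Prod.snd = (ν : Measure S) ∧
        π {p | ENNReal.ofReal η ≤ edist p.1 p.2} ≤ 3 * ENNReal.ofReal η :=
  fun _ _ _ _ _ μ _ _ hu hK hmono hmass ↦ SoftMachine.exists_subseq_presentation μ hu hK hmono hmass

end Summit.CriticalPhenomena.CardyFormulaZ2.Cruxes.NestingRigidity.PositiveConeWeightDoubling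

end
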